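import Literature.NumberTheory.Transcendental.NesterenkoLocalUnmixed
import Literature.NumberTheory.Transcendental.NesterenkoElimination
import Literature.RingTheory.MvPolynomial.HomogeneousDimension
import Literature.RingTheory.MvPolynomial.HomogeneousHilbertFunction
import Literature.RingTheory.GradedAlgebra.HomogeneousAssociatedPrimes
import Mathlib.RingTheory.Ideal.AssociatedPrime.Finiteness
import Mathlib.RingTheory.Ideal.AssociatedPrime.Localization
import Mathlib.RingTheory.Regular.RegularSequence
import HarnessLib

/-!
# Space complete intersections for the `t = 3` cycle property, I: Macaulay unmixedness and linear
# non-zero-divisors in `ℚ[x₀, …, x₃]` (helpers for stub `CycleAPIAt3`, stmt-Schanuel-6117)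

Crux `stmt-Schanuel-6117` (`Summit.Schanuel.Schanuel.Theses.DiophantineDichotomy.ApproximationProperty`),
route `DiophantineDichotomy`, line `orbit-interpolation-determinant`, registered stub `CycleAPIAt3 :
CycleAPIAt 3` (skeleton v6). Everything here is PROVED; no definitions, no named facts. This file and
its sequels (`…SpaceCIHilbert.lean`, `…SpaceCIOrbitCurve.lean`) are the `ℚ[x₀, x₁, x₂, x₃]` (`Rx 3`)
analogue of the landed plane toolkit (stubs D and E, `…CIDecomposition.lean`, `…CIInterpolation.lean`)
that a three-cut descent in `ℙ³` needs (third cut through a small space curve, interpolation for the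
output orbits).

Let `Q ≠ 0` be a form of degree `a ≥ 1` generating a prime ideal and `R ∉ (Q)` a form of degree
`b ≥ 1`, so that `(Q, R)` is a complete intersection; let `G` be a form of degree `g ≥ 1` which is a
non-zero-divisor modulo `(Q, R)`.

* `SpaceCI.nzd_of_forall_notMem`, `SpaceCI.notMem_of_mem_associatedPrimes_of_nzd`,
  `SpaceCI.notMem_of_mem_minimalPrimes_of_nzd` — non-zero-divisors modulo `J` versus the associated /
  minimal primes of `S/J` (any number of variables).
* `SpaceCI.ringKrullDim_quotient_eq_two` — every associated prime of `S/(Q, R)` has coheight `2`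
  (Macaulay's theorem for the avoiding sequence `[Q, R]` at the irrelevant ideal, tree
  `Nesterenko.ringKrullDim_quotient_eq_of_mem_associatedPrimes_of_avoids`, `m = 3`).
* `SpaceCI.ringKrullDim_quotient_eq_one` — every associated prime of `S/(Q, R, G)` has coheight `1`
  (same, sequence `[Q, R, G]`).
* `SpaceCI.exists_linear_nzd` — a non-zero linear form outside finitely many given primes (each
  missing a variable) which is a non-zero-divisor modulo a given `J` whose associated primes have
  positive coheight (prime avoidance in `S_1`).

Sources: Nesterenko–Philippon (eds.), LNM 1752, Ch. 10 §3 (Macaulay's unmixedness theorem) and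
Ch. 11, proof of Prop. 2.2 (prime avoidance by linear forms).
-/

set_option linter.dupNamespace false

noncomputable section

namespace Summit.Schanuel.Schanuel.Cruxes.ApproximationProperty.OrbitInterpolationDeterminant

open Literature.NumberTheory.Transcendental.Nesterenko MvPolynomial Module
open Literature.RingTheory.MvPolynomial

namespace SpaceCI

/-! ## Generalities: forms, spans, non-zero-divisors -/

/-- A form of positive degree lies in the irrelevant ideal `ker constantCoeff`. [folklore] -/
theorem mem_ker_constantCoeff_of_isHomogeneous {m : ℕ} {P : Rx m} {n : ℕ} (hP : P.IsHomogeneous n)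
    (hn : 1 ≤ n) : P ∈ RingHom.ker (constantCoeff : Rx m →+* ℚ) := by
  rw [RingHom.mem_ker, constantCoeff_eq]
  exact hP.coeff_eq_zero (by rw [map_zero]; omega)

/-- `span {P}` is a homogeneous ideal for a form `P`. [folklore] -/
theorem isHomogeneous_span {m : ℕ} [GradedAlgebra (homogeneousSubmodule (Fin (m + 1)) ℚ)]
    {P : Rx m} {n : ℕ} (hP : P.IsHomogeneous n) :
    (Ideal.span {P}).IsHomogeneous (homogeneousSubmodule (Fin (m + 1)) ℚ) :=
  Ideal.homogeneous_span _ _ fun x hx => ⟨n, by rw [Set.mem_singleton_iff.mp hx]; exact hP⟩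

/-- A non-zero form of positive degree is not a member of a proper... more precisely: `R ∉ (Q)`
forces `R ≠ 0`. [folklore] -/
theorem ne_zero_of_notMem {m : ℕ} {Q R : Rx m} (hRQ : R ∉ Ideal.span {Q}) : R ≠ 0 := by
  rintro rfl
  exact hRQ (Ideal.zero_mem _)

/-- The module action of `S` on `S/J` on representatives: `x • [f] = [x f]`. [folklore] -/
theorem smul_mk_eq_mk_mul {m : ℕ} (J : Ideal (Rx m)) (x f : Rx m) :
    x • Ideal.Quotient.mk J f = Ideal.Quotient.mk J (x * f) := by
  rw [← Ideal.Quotient.mk_eq_mk, ← Ideal.Quotient.mk_eq_mk, ← smul_eq_mul, Submodule.Quotient.mk_smul]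

/-- **An element outside every associated prime of `S/J` is a non-zero-divisor modulo `J`**
(the zero-divisors of a Noetherian module are the union of its associated primes). [folklore] -/
theorem nzd_of_forall_notMem {m : ℕ} {J : Ideal (Rx m)} {x : Rx m}
    (hx : ∀ 𝔯 ∈ associatedPrimes (Rx m) (Rx m ⧸ J), x ∉ 𝔯) :
    ∀ f, x * f ∈ J → f ∈ J := by
  intro f hf
  by_contra hfJ
  have hmk : Ideal.Quotient.mk J f ≠ 0 := mt Ideal.Quotient.eq_zero_iff_mem.mp hfJ
  have hzero : x • Ideal.Quotient.mk J f = 0 := by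
    rw [smul_mk_eq_mk_mul, Ideal.Quotient.eq_zero_iff_mem]
    exact hf
  have hmem : x ∈ {r : Rx m | ∃ y : Rx m ⧸ J, y ≠ 0 ∧ r • y = 0} := ⟨_, hmk, hzero⟩
  rw [← biUnion_associatedPrimes_eq_zero_divisors] at hmem
  obtain ⟨𝔯, h𝔯, hx𝔯⟩ := Set.mem_iUnion₂.mp hmem
  exact hx 𝔯 h𝔯 hx𝔯

/-- **A non-zero-divisor modulo `J` lies in no associated prime of `S/J`.** [folklore] -/
theorem notMem_of_mem_associatedPrimes_of_nzd {m : ℕ} {J : Ideal (Rx m)} {x : Rx m}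
    (hnzd : ∀ f, x * f ∈ J → f ∈ J) {𝔯 : Ideal (Rx m)}
    (h𝔯 : 𝔯 ∈ associatedPrimes (Rx m) (Rx m ⧸ J)) : x ∉ 𝔯 := by
  intro hx
  have hmem : x ∈ ⋃ 𝔯 ∈ associatedPrimes (Rx m) (Rx m ⧸ J), (𝔯 : Set (Rx m)) :=
    Set.mem_iUnion₂.mpr ⟨𝔯, h𝔯, hx⟩
  rw [biUnion_associatedPrimes_eq_zero_divisors] at hmem
  obtain ⟨y, hy0, hxy⟩ := hmem
  obtain ⟨f, rfl⟩ := Ideal.Quotient.mk_surjective y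
  apply hy0
  rw [Ideal.Quotient.eq_zero_iff_mem]
  apply hnzd
  rw [smul_mk_eq_mk_mul, Ideal.Quotient.eq_zero_iff_mem] at hxy
  exact hxy

/-- **A non-zero-divisor modulo `J` lies in no minimal prime of `J`** (minimal primes are
associated). [folklore] -/
theorem notMem_of_mem_minimalPrimes_of_nzd {m : ℕ} {J : Ideal (Rx m)} {x : Rx m}
    (hnzd : ∀ f, x * f ∈ J → f ∈ J) {𝔮 : Ideal (Rx m)} (h𝔮 : 𝔮 ∈ J.minimalPrimes) : x ∉ 𝔮 := by
  refine notMem_of_mem_associatedPrimes_of_nzd hnzd ?_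
  have h := Module.associatedPrimes.minimalPrimes_annihilator_subset_associatedPrimes (Rx m) (Rx m ⧸ J)
  rw [Ideal.annihilator_quotient] at h
  exact h h𝔮

/-- A non-zero-divisor modulo a proper ideal `J` is not in `J`, in particular non-zero. [folklore] -/
theorem notMem_of_nzd {m : ℕ} {J : Ideal (Rx m)} (hJ : J ≠ ⊤) {x : Rx m}
    (hnzd : ∀ f, x * f ∈ J → f ∈ J) : x ∉ J := fun hx =>
  hJ ((Ideal.eq_top_iff_one J).mpr (hnzd 1 (by rw [mul_one]; exact hx)))

/-! ## Macaulay: the complete intersections `(Q, R)` and `(Q, R, G)` of `ℚ[x₀, …, x₃]` -/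

section Macaulay

variable {Q R G : Rx 3} {a b g : ℕ}

/-- The ideal `(Q, R)` is proper (it lies in the irrelevant ideal). [folklore] -/
theorem span_sup_span_ne_top (hQ : Q.IsHomogeneous a) (hR : R.IsHomogeneous b) (ha : 1 ≤ a)
    (hb : 1 ≤ b) : Ideal.span {Q} ⊔ Ideal.span {R} ≠ ⊤ := by
  intro htop
  have hle : Ideal.span {Q} ⊔ Ideal.span {R} ≤ RingHom.ker (constantCoeff : Rx 3 →+* ℚ) :=
    sup_le ((Ideal.span_singleton_le_iff_mem _).mpr (mem_ker_constantCoeff_of_isHomogeneous hQ ha))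
      ((Ideal.span_singleton_le_iff_mem _).mpr (mem_ker_constantCoeff_of_isHomogeneous hR hb))
  rw [htop, top_le_iff] at hle
  exact (RingHom.ker_ne_top (constantCoeff : Rx 3 →+* ℚ)) hle

/-- **Macaulay's unmixedness for a space complete intersection of two forms.** For `Q ≠ 0` a form
of degree `a ≥ 1` with `(Q)` prime and `R ∉ (Q)` a form of degree `b ≥ 1`, every associated prime
`𝔯` of `S/(Q, R)`, `S = ℚ[x₀, …, x₃]`, has `dim S/𝔯 = 2`.
[cite: NesterenkoPhilippon2001, Ch. 10 §3, proof of Prop. 3.6] -/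
theorem ringKrullDim_quotient_eq_two (hQ0 : Q ≠ 0) (hQ : Q.IsHomogeneous a)
    (hR : R.IsHomogeneous b) (ha : 1 ≤ a) (hb : 1 ≤ b) (hprime : (Ideal.span {Q}).IsPrime)
    (hRQ : R ∉ Ideal.span {Q}) {𝔯 : Ideal (Rx 3)}
    (h𝔯 : 𝔯 ∈ associatedPrimes (Rx 3) (Rx 3 ⧸ (Ideal.span {Q} ⊔ Ideal.span {R}))) :
    ringKrullDim (Rx 3 ⧸ 𝔯) = (2 : ℕ) := by
  letI : GradedAlgebra (homogeneousSubmodule (Fin (3 + 1)) ℚ) := MvPolynomial.gradedAlgebra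
  have hE : Ideal.ofList [Q, R] = Ideal.span {Q} ⊔ Ideal.span {R} := by
    rw [Ideal.ofList_cons, Ideal.ofList_singleton]
  rw [← hE] at h𝔯
  have h𝔯' := (mem_associatedPrimes_quotient_iff _ _).mp h𝔯
  set 𝔪 : Ideal (Rx 3) := RingHom.ker (constantCoeff : Rx 3 →+* ℚ)
  haveI : 𝔪.IsPrime := isMaximal_ker_constantCoeff.isPrime
  have hE𝔪 : ∀ e ∈ [Q, R], e ∈ 𝔪 := by
    intro e he
    simp only [List.mem_cons, List.not_mem_nil, or_false] at he
    rcases he with rfl | rfl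
    · exact mem_ker_constantCoeff_of_isHomogeneous hQ ha
    · exact mem_ker_constantCoeff_of_isHomogeneous hR hb
  have havoid : ∀ (L₁ : List (Rx 3)) (e : Rx 3) (L₂ : List (Rx 3)), [Q, R] = L₁ ++ e :: L₂ →
      ∀ 𝔮 ∈ (Ideal.ofList L₁).minimalPrimes, 𝔮 ≤ 𝔪 → e ∉ 𝔮 := by
    intro L₁ e L₂ hsplit 𝔮 h𝔮 _
    rcases L₁ with _ | ⟨x, _ | ⟨y, L₁'⟩⟩
    · rw [List.nil_append] at hsplit
      obtain ⟨hQe, -⟩ := List.cons_eq_cons.mp hsplit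
      rw [Ideal.ofList_nil, Ideal.minimalPrimes_eq_subsingleton_self, Set.mem_singleton_iff] at h𝔮
      rw [← hQe, h𝔮, Ideal.mem_bot]
      exact hQ0
    · rw [List.singleton_append] at hsplit
      obtain ⟨hQx, hrest⟩ := List.cons_eq_cons.mp hsplit
      obtain ⟨hRe, -⟩ := List.cons_eq_cons.mp hrest
      rw [← hQx, Ideal.ofList_singleton] at h𝔮
      haveI := hprime
      rw [Ideal.minimalPrimes_eq_subsingleton_self, Set.mem_singleton_iff] at h𝔮
      rw [← hRe, h𝔮]
      exact hRQ
    · have := congrArg List.length hsplit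
      simp only [List.length_cons, List.length_append, List.length_nil] at this
      omega
  have hJhom : (Ideal.ofList [Q, R]).IsHomogeneous (homogeneousSubmodule (Fin (3 + 1)) ℚ) := by
    rw [hE]; exact (isHomogeneous_span hQ).sup (isHomogeneous_span hR)
  have h𝔯hom := Literature.RingTheory.GradedAlgebra.isHomogeneous_of_mem_associatedPrimes
    (homogeneousSubmodule (Fin (3 + 1)) ℚ) hJhom h𝔯'
  have h𝔯𝔪 : 𝔯 ≤ 𝔪 :=
    le_ker_constantCoeff_of_isHomogeneous h𝔯hom (IsAssociatedPrime.isPrime h𝔯).ne_top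
  have h := (ringKrullDim_quotient_eq_of_mem_associatedPrimes_of_avoids (m := 3) 𝔪 hE𝔪 havoid
    h𝔯' h𝔯𝔪).2.2
  rw [h]
  rfl

/-- **Macaulay's unmixedness for a space complete intersection of three forms.** With `Q`, `R` as
in `ringKrullDim_quotient_eq_two` and `G` a form of degree `g ≥ 1` which is a non-zero-divisor
modulo `(Q, R)`, every associated prime `𝔯` of `S/(Q, R, G)` has `dim S/𝔯 = 1`.
[cite: NesterenkoPhilippon2001, Ch. 10 §3, proof of Prop. 3.6] -/
theorem ringKrullDim_quotient_eq_one (hQ0 : Q ≠ 0) (hQ : Q.IsHomogeneous a)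
    (hR : R.IsHomogeneous b) (hG : G.IsHomogeneous g) (ha : 1 ≤ a) (hb : 1 ≤ b) (hg : 1 ≤ g)
    (hprime : (Ideal.span {Q}).IsPrime) (hRQ : R ∉ Ideal.span {Q})
    (hGnzd : ∀ f, G * f ∈ Ideal.span {Q} ⊔ Ideal.span {R} → f ∈ Ideal.span {Q} ⊔ Ideal.span {R})
    {𝔯 : Ideal (Rx 3)}
    (h𝔯 : 𝔯 ∈ associatedPrimes (Rx 3)
      (Rx 3 ⧸ (Ideal.span {Q} ⊔ Ideal.span {R} ⊔ Ideal.span {G}))) :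
    ringKrullDim (Rx 3 ⧸ 𝔯) = (1 : ℕ) := by
  letI : GradedAlgebra (homogeneousSubmodule (Fin (3 + 1)) ℚ) := MvPolynomial.gradedAlgebra
  have hE2 : Ideal.ofList [Q, R] = Ideal.span {Q} ⊔ Ideal.span {R} := by
    rw [Ideal.ofList_cons, Ideal.ofList_singleton]
  have hE : Ideal.ofList [Q, R, G] = Ideal.span {Q} ⊔ Ideal.span {R} ⊔ Ideal.span {G} := by
    rw [Ideal.ofList_cons, Ideal.ofList_cons, Ideal.ofList_singleton, sup_assoc]
  rw [← hE] at h𝔯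
  have h𝔯' := (mem_associatedPrimes_quotient_iff _ _).mp h𝔯
  set 𝔪 : Ideal (Rx 3) := RingHom.ker (constantCoeff : Rx 3 →+* ℚ)
  haveI : 𝔪.IsPrime := isMaximal_ker_constantCoeff.isPrime
  have hE𝔪 : ∀ e ∈ [Q, R, G], e ∈ 𝔪 := by
    intro e he
    simp only [List.mem_cons, List.not_mem_nil, or_false] at he
    rcases he with rfl | rfl | rfl
    · exact mem_ker_constantCoeff_of_isHomogeneous hQ ha
    · exact mem_ker_constantCoeff_of_isHomogeneous hR hb
    · exact mem_ker_constantCoeff_of_isHomogeneous hG hg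
  have havoid : ∀ (L₁ : List (Rx 3)) (e : Rx 3) (L₂ : List (Rx 3)), [Q, R, G] = L₁ ++ e :: L₂ →
      ∀ 𝔮 ∈ (Ideal.ofList L₁).minimalPrimes, 𝔮 ≤ 𝔪 → e ∉ 𝔮 := by
    intro L₁ e L₂ hsplit 𝔮 h𝔮 _
    rcases L₁ with _ | ⟨x, _ | ⟨y, _ | ⟨z, L₁'⟩⟩⟩
    · rw [List.nil_append] at hsplit
      obtain ⟨hQe, -⟩ := List.cons_eq_cons.mp hsplit
      rw [Ideal.ofList_nil, Ideal.minimalPrimes_eq_subsingleton_self, Set.mem_singleton_iff] at h𝔮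
      rw [← hQe, h𝔮, Ideal.mem_bot]
      exact hQ0
    · rw [List.singleton_append] at hsplit
      obtain ⟨hQx, hrest⟩ := List.cons_eq_cons.mp hsplit
      obtain ⟨hRe, -⟩ := List.cons_eq_cons.mp hrest
      rw [← hQx, Ideal.ofList_singleton] at h𝔮
      haveI := hprime
      rw [Ideal.minimalPrimes_eq_subsingleton_self, Set.mem_singleton_iff] at h𝔮
      rw [← hRe, h𝔮]
      exact hRQ
    · have hsplit' : [Q, R, G] = [x, y] ++ e :: L₂ := hsplit
      rw [show [x, y] ++ e :: L₂ = x :: y :: e :: L₂ from rfl] at hsplit'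
      obtain ⟨hQx, hrest⟩ := List.cons_eq_cons.mp hsplit'
      obtain ⟨hRy, hrest'⟩ := List.cons_eq_cons.mp hrest
      obtain ⟨hGe, -⟩ := List.cons_eq_cons.mp hrest'
      rw [← hQx, ← hRy, hE2] at h𝔮
      rw [← hGe]
      exact notMem_of_mem_minimalPrimes_of_nzd hGnzd h𝔮
    · have := congrArg List.length hsplit
      simp only [List.length_cons, List.length_append, List.length_nil] at this
      omega
  have hJhom : (Ideal.ofList [Q, R, G]).IsHomogeneous (homogeneousSubmodule (Fin (3 + 1)) ℚ) := by
    rw [hE]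
    exact ((isHomogeneous_span hQ).sup (isHomogeneous_span hR)).sup (isHomogeneous_span hG)
  have h𝔯hom := Literature.RingTheory.GradedAlgebra.isHomogeneous_of_mem_associatedPrimes
    (homogeneousSubmodule (Fin (3 + 1)) ℚ) hJhom h𝔯'
  have h𝔯𝔪 : 𝔯 ≤ 𝔪 :=
    le_ker_constantCoeff_of_isHomogeneous h𝔯hom (IsAssociatedPrime.isPrime h𝔯).ne_top
  have h := (ringKrullDim_quotient_eq_of_mem_associatedPrimes_of_avoids (m := 3) 𝔪 hE𝔪 havoid
    h𝔯' h𝔯𝔪).2.2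
  rw [h]
  rfl

/-- **A linear non-zero-divisor by prime avoidance.** Given a proper ideal `J` all of whose
associated primes have positive coheight and a finite family `P` of primes each missing some
variable, there is a non-zero linear form outside every member of `P` which is a non-zero-divisor
modulo `J`. [cite: NesterenkoPhilippon2001, Ch. 11, proof of Prop. 2.2] -/
theorem exists_linear_nzd {J : Ideal (Rx 3)}
    (hJ : ∀ 𝔯 ∈ associatedPrimes (Rx 3) (Rx 3 ⧸ J), ringKrullDim (Rx 3 ⧸ 𝔯) ≠ 0)
    (P : Finset (Ideal (Rx 3))) (hP : ∀ 𝔭 ∈ P, ∃ i, (X i : Rx 3) ∉ 𝔭) :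
    ∃ L : Rx 3, L.IsHomogeneous 1 ∧ L ≠ 0 ∧ (∀ 𝔭 ∈ P, L ∉ 𝔭) ∧
      ∀ f, L * f ∈ J → f ∈ J := by
  classical
  have hfin := associatedPrimes.finite (Rx 3) (Rx 3 ⧸ J)
  have hP' : ∀ 𝔭 ∈ P ∪ hfin.toFinset, ∃ i, (X i : Rx 3) ∉ 𝔭 := by
    intro 𝔭 h𝔭
    rcases Finset.mem_union.mp h𝔭 with h𝔭 | h𝔭
    · exact hP 𝔭 h𝔭
    · have h𝔯 := hfin.mem_toFinset.mp h𝔭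
      haveI : 𝔭.IsPrime := IsAssociatedPrime.isPrime h𝔯
      exact exists_X_notMem_of_ringKrullDim_ne_zero (hJ 𝔭 h𝔯)
  obtain ⟨L, hL1, hL0, hL⟩ := exists_linearForm_forall_notMem (K := ℚ) (m := 3 + 1)
    (Nat.succ_pos 3) (P ∪ hfin.toFinset) hP'
  refine ⟨L, hL1, hL0, fun 𝔭 h𝔭 => hL 𝔭 (Finset.mem_union_left _ h𝔭), ?_⟩
  exact nzd_of_forall_notMem fun 𝔯 h𝔯 => hL 𝔯 (Finset.mem_union_right _ (hfin.mem_toFinset.mpr h𝔯))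

end Macaulay

end SpaceCI

/-- **Registered sub-goal `spaceCI_unmixed`** (helper for stub `CycleAPIAt3`): Macaulay's unmixedness
for the space complete intersections `(Q, R)` (coheight `2`) and `(Q, R, G)` (coheight `1`) of
`ℚ[x₀, …, x₃]`. [cite: NesterenkoPhilippon2001, Ch. 10 §3, proof of Prop. 3.6] -/
theorem spaceCI_unmixed : ∀ (Q R G : Rx 3) (a b g : ℕ), Q ≠ 0 → Q.IsHomogeneous a → R.IsHomogeneous b → G.IsHomogeneous g → 1 ≤ a → 1 ≤ b → 1 ≤ g → (Ideal.span {Q}).IsPrime → R ∉ Ideal.span {Q} → (∀ f, G * f ∈ Ideal.span {Q} ⊔ Ideal.span {R} → f ∈ Ideal.span {Q} ⊔ Ideal.span {R}) → (∀ 𝔯 ∈ associatedPrimes (Rx 3) (Rx 3 ⧸ (Ideal.span {Q} ⊔ Ideal.span {R})), ringKrullDim (Rx 3 ⧸ 𝔯) = (2 : ℕ)) ∧ (∀ 𝔯 ∈ associatedPrimes (Rx 3) (Rx 3 ⧸ (Ideal.span {Q} ⊔ Ideal.span {R} ⊔ Ideal.span {G})), ringKrullDim (Rx 3 ⧸ 𝔯)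 = (1 : ℕ)) := by
  intro Q R G a b g hQ0 hQ hR hG ha hb hg hprime hRQ hGnzd
  exact ⟨fun 𝔯 h𝔯 => SpaceCI.ringKrullDim_quotient_eq_two hQ0 hQ hR ha hb hprime hRQ h𝔯,
    fun 𝔯 h𝔯 => SpaceCI.ringKrullDim_quotient_eq_one hQ0 hQ hR hG ha hb hg hprime hRQ hGnzd h𝔯⟩

end Summit.Schanuel.Schanuel.Cruxes.ApproximationProperty.OrbitInterpolationDeterminant

end
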